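import Literature.Probability.RandomPlanarGeometry.SLEDerivRatioSupersolution
import HarnessLib

/-!
# Elementary supersolutions for all moments `a < 1 - κ/8` of Rohde–Schramm's derivative ratio

Deterministic (calculus) layer of the almost-sure **upper bound `dim_H γ[0,∞) ≤ 1 + κ/8`** for the
SLE_κ trace (Rohde–Schramm, *Basic properties of SLE*, Ann. of Math. 161 (2005), **Thm 8.1 /
Cor 8.2**), obtained in this tree through the moments of the derivative ratio
`Z(z) = lim_{t ↑ τ(z)} (Im z)|gₜ'(z)|/Im gₜ(z)` of **Lemma 6.3**: `E[Z(z)^a] < ∞` for every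
`a < 1 - κ/8` (and `= ∞` for `a ≥ 1 - κ/8`), uniformly in `z ∈ ℍ`.

The printed proof computes `E[Z^a] = Ĝ_{a,κ}(z)/Ĝ_{a,κ}(1)` with the hypergeometric solution
`Ĝ_{a,κ}` of the generator equation and needs the analytic input (6.10) `inf Ĝ > 0` (Gauss's
summation formula (6.11) and a maximum-principle argument, pp. 905–906). For an **upper** bound on
the moments an exact solution is not needed: any `C²` function `G` with `1 ≤ G ≤ M` and
`D_{a,κ} G ≤ 0`, where

  `D_{a,κ} G (w) = 4a G(w)/(1+w²)² + 4w G'(w)/(1+w²) + (κ/2) G''(w)`     (`rsDriftOp`)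

is the drift functional of `Rₜ^a G(xₜ/yₜ)` (Rohde–Schramm p. 904; in the tree `rsSuperDrift` is the
special case `G = rsSuperG κ`, `a = rsSuperExp κ = κ(8-κ)/(32(κ+2))` of
`SLEDerivRatioSupersolution.lean`), makes `Rₜ^a G(wₜ)` a non-negative supermartingale and gives
`E[Z^a] ≤ G(x/y) ≤ M`. This file constructs such a supersolution for **every** `0 < κ < 8` and
**every** `0 ≤ a < 1 - κ/8` (the full printed range of finite moments), in the three-parameter
family

  `rsSuperFamily β D E (w) = 1 + D (1+w²)^{-β} + E (1+w²)^{-1}`,   `D, E ≥ 0`,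

and proves `D_{a,κ} ≤ 0` for it (`exists_rsSuperFamily_drift_nonpos`). With `s = 1 + w²`,
`β₀ = (8-κ)/(2κ)` (the exponent of Rohde–Schramm's exact critical solution `(y/|z|)^{(8-κ)/κ} =
s^{-β₀}`, p. 905) and the single-power identity

  `D_{a,κ}[s^{-β}] = s^{-β-2} ((4a - κβ) + β(2κβ + κ - 8) w²)`     (`rsDriftOp_rsPow`)

(negative as soon as `4a/κ < β < β₀` — this open interval is non-empty exactly when `a < 1 - κ/8`):

* if `a < κ/4`: `E = 0`, `β ∈ (4a/κ, min(1, β₀))`, and Bernoulli's inequality `s^β ≤ 1 + βw²`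
  absorbs the positive drift `4a/s²` of the constant `1` (`rsSuperFamily_drift_nonpos_of_lt`);
* if `a ≥ κ/4` (which forces `κ < 8/3`, `β₀ > 1`): `β ∈ (4a/κ, β₀)` is now `> 1` and the term
  `D s^{-β}` is too flat near `w = ∞`; the extra term `E s^{-1}` with `E = 8a/(8-3κ)` has drift
  `E s^{-3}((4a-κ) + (3κ-8)w²)`, which together with `4a/s²` is `s^{-3}(c₀ - 4a w²)`, negative for
  large `w`, while `D = c₀(1+q_r)^{β-1}/(κβ-4a)` handles `w² ≤ q_r = c₀/4a`
  (`rsSuperFamily_drift_nonpos_of_le`).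

Nothing here is specific to SLE: pure one-variable calculus, consumed by the stochastic layer
(`SLEDerivRatioMoments.lean`). What is NOT here: the exact hypergeometric solution, the lower bound
`E[Z^a] = ∞` for `a ≥ 1 - κ/8`, and any probability.

## Mathlib

We USE `Real.rpow` calculus (`HasDerivAt.rpow_const`, `ContDiff.rpow_const_of_ne`, `Real.rpow_add`,
`Real.rpow_sub`, `Real.rpow_neg`, `Real.rpow_le_rpow`, `Real.rpow_le_one_of_one_le_of_nonpos`),
`iteratedDeriv_succ`, and Bernoulli's inequality `rpow_one_add_le_one_add_mul_self`.

## References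

* S. Rohde, O. Schramm, *Basic properties of SLE*, Ann. of Math. 161 (2005) 883–924: Lemma 6.3
  and its proof, eqs. (6.3)–(6.5), (6.9), (6.10) (pp. 903–906); Thm 8.1, Cor 8.2 (p. 914).
-/

noncomputable section

open Set Real

namespace Literature.Probability.RandomPlanarGeometry

/-! ### The drift functional `D_{a,κ}` for a general `G` -/

/-- **Rohde–Schramm's drift functional** for the observable `Rₜ^a G(wₜ)`, `wₜ = xₜ/yₜ`, as a
functional of a general profile `G : ℝ → ℝ` and moment exponent `a`:
`D_{a,κ} G (w) = 4a G(w)/(1+w²)² + 4w G'(w)/(1+w²) + (κ/2) G''(w)` (derivatives as Mathlib's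
`deriv`, `iteratedDeriv 2`). The drift of `Rₜ^a G(xₜ/yₜ)` is `(Rₜ^a/yₜ²) D_{a,κ}G(wₜ)` (from (6.4)
`∂ₜ log Rₜ = 4yₜ²/|zₜ|⁴`, `dx = (2x/|z|²)dt - dW`, `ẏ = -2y/|z|²`, `d⟨x⟩ = κ dt`); `rsSuperDrift κ` is
the special case `G = rsSuperG κ`, `a = rsSuperExp κ` (`rsDriftOp_rsSuperG`).
[cite: RohdeSchramm2005, Lemma 6.3 (proof, p. 904)] -/
def rsDriftOp (κ a : ℝ) (G : ℝ → ℝ) (w : ℝ) : ℝ :=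
  4 * a * G w / (1 + w ^ 2) ^ 2 + 4 * w * deriv G w / (1 + w ^ 2) + κ / 2 * iteratedDeriv 2 G w

/-- Consistency with the tree: `rsSuperDrift κ = D_{a(κ),κ} (rsSuperG κ)`. [folklore] -/
theorem rsDriftOp_rsSuperG (κ w : ℝ) :
    rsDriftOp κ (rsSuperExp κ) (rsSuperG κ) w = rsSuperDrift κ w := rfl

/-! ### The powers `s^{-β}`, `s = 1 + w²` -/

/-- The profile `P_β(w) = (1 + w²)^{-β}` (`= (y/|z|)^{2β}` at `w = x/y`). [folklore] -/
def rsPow (β w : ℝ) : ℝ :=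
  (1 + w ^ 2) ^ (-β)

section Pow

variable (β : ℝ) {w : ℝ}

/-- Unfolding of `rsPow`. [folklore] -/
theorem rsPow_apply (w : ℝ) : rsPow β w = (1 + w ^ 2) ^ (-β) := rfl

/-- `P_β > 0`. [folklore] -/
theorem rsPow_pos (w : ℝ) : 0 < rsPow β w :=
  rpow_pos_of_pos (one_add_sq_pos' w) _

variable {β} in
/-- `P_β ≤ 1` for `β ≥ 0`. [folklore] -/
theorem rsPow_le_one (hβ : 0 ≤ β) (w : ℝ) : rsPow β w ≤ 1 := by
  rw [rsPow_apply]
  have h1 : (1 : ℝ) ≤ 1 + w ^ 2 := by nlinarith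
  exact rpow_le_one_of_one_le_of_nonpos h1 (neg_nonpos.2 hβ)

/-- **First derivative**: `P_β'(w) = -2βw (1+w²)^{-β-1}`. [folklore] -/
theorem hasDerivAt_rsPow (w : ℝ) :
    HasDerivAt (rsPow β) (-2 * β * w * (1 + w ^ 2) ^ (-β - 1)) w := by
  have hu : HasDerivAt (fun w : ℝ ↦ 1 + w ^ 2) (2 * w) w := by
    simpa using (hasDerivAt_pow 2 w).const_add 1
  have h : HasDerivAt (fun w : ℝ ↦ (1 + w ^ 2) ^ (-β))
      (2 * w * (-β) * (1 + w ^ 2) ^ (-β - 1)) w :=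
    hu.rpow_const (p := -β) (Or.inl (one_add_sq_pos' w).ne')
  exact h.congr_deriv (by ring)

/-- `deriv P_β w = -2βw (1+w²)^{-β-1}`. [folklore] -/
theorem deriv_rsPow (w : ℝ) : deriv (rsPow β) w = -2 * β * w * (1 + w ^ 2) ^ (-β - 1) :=
  (hasDerivAt_rsPow β w).deriv

/-- `deriv P_β` as a function. [folklore] -/
theorem deriv_rsPow_eq : deriv (rsPow β) = fun w ↦ -2 * β * w * (1 + w ^ 2) ^ (-β - 1) :=
  funext (deriv_rsPow β)

/-- **Second derivative**: `P_β''(w) = -2β(1+w²)^{-β-1} + 4β(β+1)w²(1+w²)^{-β-2}`. [folklore] -/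
theorem hasDerivAt_deriv_rsPow (w : ℝ) :
    HasDerivAt (deriv (rsPow β))
      (-2 * β * (1 + w ^ 2) ^ (-β - 1) + 4 * β * (β + 1) * w ^ 2 * (1 + w ^ 2) ^ (-β - 2)) w := by
  have hfun : deriv (rsPow β) = fun y ↦ -2 * β * (y * (1 + y ^ 2) ^ (-β - 1)) := by
    rw [deriv_rsPow_eq]
    funext y
    ring
  rw [hfun]
  have hu : HasDerivAt (fun w : ℝ ↦ 1 + w ^ 2) (2 * w) w := by
    simpa using (hasDerivAt_pow 2 w).const_add 1
  have hp : HasDerivAt (fun y : ℝ ↦ (1 + y ^ 2) ^ (-β - 1))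
      (2 * w * (-β - 1) * (1 + w ^ 2) ^ (-β - 1 - 1)) w :=
    hu.rpow_const (p := -β - 1) (Or.inl (one_add_sq_pos' w).ne')
  have h : HasDerivAt (fun y : ℝ ↦ y * (1 + y ^ 2) ^ (-β - 1))
      (1 * (1 + w ^ 2) ^ (-β - 1) + w * (2 * w * (-β - 1) * (1 + w ^ 2) ^ (-β - 1 - 1))) w :=
    (hasDerivAt_id' w).mul hp
  refine (h.const_mul (-2 * β)).congr_deriv ?_
  have hexp : -β - 1 - 1 = -β - 2 := by ring
  have hsplit : (1 + w ^ 2) ^ (-β - 1) = (1 + w ^ 2) * (1 + w ^ 2) ^ (-β - 2) := by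
    rw [show -β - 1 = 1 + (-β - 2) by ring, rpow_add (one_add_sq_pos' w), rpow_one]
  rw [hexp, hsplit]
  ring

/-- `iteratedDeriv 2 P_β w = -2β(1+w²)^{-β-1} + 4β(β+1)w²(1+w²)^{-β-2}`. [folklore] -/
theorem iteratedDeriv_two_rsPow (w : ℝ) :
    iteratedDeriv 2 (rsPow β) w =
      -2 * β * (1 + w ^ 2) ^ (-β - 1) + 4 * β * (β + 1) * w ^ 2 * (1 + w ^ 2) ^ (-β - 2) := by
  rw [iteratedDeriv_succ, iteratedDeriv_one]
  exact (hasDerivAt_deriv_rsPow β w).deriv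

/-- `P_β` is smooth (`1 + w² > 0`). [folklore] -/
theorem contDiff_rsPow {n : WithTop ℕ∞} : ContDiff ℝ n (rsPow β) := by
  unfold rsPow
  exact (contDiff_const.add (contDiff_id.pow 2)).rpow_const_of_ne fun w ↦ (one_add_sq_pos' w).ne'

/-- **The drift of a single power**: `D_{a,κ}[s^{-β}] = s^{-β}/s² · ((4a - κβ) + β(2κβ + κ - 8)w²)`,
`s = 1 + w²`. For `β = β₀ = (8-κ)/(2κ)` and `a = 1 - κ/8` both coefficients vanish: `s^{-β₀}` is
Rohde–Schramm's exact critical solution `(y/|z|)^{(8-κ)/κ}` (p. 905).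
[cite: RohdeSchramm2005, Lemma 6.3 (proof, p. 905)] -/
theorem rsDriftOp_rsPow (κ a w : ℝ) :
    rsDriftOp κ a (rsPow β) w = (1 + w ^ 2) ^ (-β) / (1 + w ^ 2) ^ 2 *
      ((4 * a - κ * β) + β * (2 * κ * β + κ - 8) * w ^ 2) := by
  set u := 1 + w ^ 2 with hu
  have hu0 : 0 < u := one_add_sq_pos' w
  have h1 : u ^ (-β - 1) = u ^ (-β) / u := by rw [rpow_sub hu0, rpow_one]
  have h2 : u ^ (-β - 2) = u ^ (-β) / u ^ 2 := by rw [rpow_sub hu0, rpow_two]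
  rw [rsDriftOp, deriv_rsPow, iteratedDeriv_two_rsPow, rsPow_apply, ← hu, h1, h2]
  field_simp
  ring

end Pow

/-! ### The three-parameter family `1 + D s^{-β} + E s^{-1}` -/

/-- **The supersolution family** `G(w) = 1 + D (1+w²)^{-β} + E (1+w²)^{-1}`. For `D, E ≥ 0`,
`β ≥ 0`: `1 ≤ G ≤ 1 + D + E`. A technical device generalising `rsSuperG κ = rsSuperFamily β(κ) 1 0`
(no claim of provenance). [folklore] -/
def rsSuperFamily (β D E : ℝ) (w : ℝ) : ℝ :=
  1 + D * rsPow β w + E * rsPow 1 w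

section Family

variable (β D E : ℝ) {w : ℝ}

/-- Unfolding of `rsSuperFamily`. [folklore] -/
theorem rsSuperFamily_apply (w : ℝ) :
    rsSuperFamily β D E w = 1 + D * (1 + w ^ 2) ^ (-β) + E * (1 + w ^ 2) ^ (-(1 : ℝ)) := rfl

/-- The tree's `rsSuperG` is the member `β = rsSuperBeta κ`, `D = 1`, `E = 0`. [folklore] -/
theorem rsSuperG_eq_rsSuperFamily (κ : ℝ) : rsSuperG κ = rsSuperFamily (rsSuperBeta κ) 1 0 := by
  funext w
  simp [rsSuperFamily, rsSuperG_apply, rsPow_apply]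

variable {β D E} in
/-- `1 ≤ G` for `D, E ≥ 0`. [folklore] -/
theorem one_le_rsSuperFamily (hD : 0 ≤ D) (hE : 0 ≤ E) (w : ℝ) : 1 ≤ rsSuperFamily β D E w := by
  have h1 := mul_nonneg hD (rsPow_pos β w).le
  have h2 := mul_nonneg hE (rsPow_pos 1 w).le
  unfold rsSuperFamily
  linarith

variable {β D E} in
/-- `0 < G` for `D, E ≥ 0`. [folklore] -/
theorem rsSuperFamily_pos (hD : 0 ≤ D) (hE : 0 ≤ E) (w : ℝ) : 0 < rsSuperFamily β D E w :=
  one_pos.trans_le (one_le_rsSuperFamily hD hE w)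

variable {β D E} in
/-- `G ≤ 1 + D + E` for `β, D, E ≥ 0`. [folklore] -/
theorem rsSuperFamily_le (hβ : 0 ≤ β) (hD : 0 ≤ D) (hE : 0 ≤ E) (w : ℝ) :
    rsSuperFamily β D E w ≤ 1 + D + E := by
  have h1 := mul_le_of_le_one_right hD (rsPow_le_one hβ w)
  have h2 := mul_le_of_le_one_right hE (rsPow_le_one zero_le_one w)
  unfold rsSuperFamily
  linarith

/-- **First derivative** of the family. [folklore] -/
theorem hasDerivAt_rsSuperFamily (w : ℝ) :
    HasDerivAt (rsSuperFamily β D E)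
      (D * (-2 * β * w * (1 + w ^ 2) ^ (-β - 1)) + E * (-2 * 1 * w * (1 + w ^ 2) ^ (-(1 : ℝ) - 1))) w := by
  have h := (((hasDerivAt_rsPow β w).const_mul D).const_add 1).add ((hasDerivAt_rsPow 1 w).const_mul E)
  exact h.congr_deriv (by ring)

/-- `deriv G` as a function. [folklore] -/
theorem deriv_rsSuperFamily_eq :
    deriv (rsSuperFamily β D E) = fun w ↦
      D * (-2 * β * w * (1 + w ^ 2) ^ (-β - 1)) + E * (-2 * 1 * w * (1 + w ^ 2) ^ (-(1 : ℝ) - 1)) :=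
  funext fun w ↦ (hasDerivAt_rsSuperFamily β D E w).deriv

/-- `deriv G = D · deriv P_β + E · deriv P_1`. [folklore] -/
theorem deriv_rsSuperFamily_eq' :
    deriv (rsSuperFamily β D E) = fun w ↦ D * deriv (rsPow β) w + E * deriv (rsPow 1) w := by
  rw [deriv_rsSuperFamily_eq]
  funext w
  rw [deriv_rsPow, deriv_rsPow]

/-- **Second derivative** of the family. [folklore] -/
theorem hasDerivAt_deriv_rsSuperFamily (w : ℝ) :
    HasDerivAt (deriv (rsSuperFamily β D E))
      (D * (-2 * β * (1 + w ^ 2) ^ (-β - 1) + 4 * β * (β + 1) * w ^ 2 * (1 + w ^ 2) ^ (-β - 2)) +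
        E * (-2 * 1 * (1 + w ^ 2) ^ (-(1 : ℝ) - 1) +
          4 * 1 * (1 + 1) * w ^ 2 * (1 + w ^ 2) ^ (-(1 : ℝ) - 2))) w := by
  rw [deriv_rsSuperFamily_eq']
  exact ((hasDerivAt_deriv_rsPow β w).const_mul D).add ((hasDerivAt_deriv_rsPow 1 w).const_mul E)

/-- `iteratedDeriv 2 G = D · P_β'' + E · P_1''`. [folklore] -/
theorem iteratedDeriv_two_rsSuperFamily (w : ℝ) :
    iteratedDeriv 2 (rsSuperFamily β D E) w =
      D * iteratedDeriv 2 (rsPow β) w + E * iteratedDeriv 2 (rsPow 1) w := by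
  rw [iteratedDeriv_succ, iteratedDeriv_one, (hasDerivAt_deriv_rsSuperFamily β D E w).deriv,
    iteratedDeriv_two_rsPow, iteratedDeriv_two_rsPow]

/-- The family is smooth. [folklore] -/
theorem contDiff_rsSuperFamily {n : WithTop ℕ∞} : ContDiff ℝ n (rsSuperFamily β D E) := by
  unfold rsSuperFamily
  exact (contDiff_const.add (contDiff_const.mul (contDiff_rsPow β))).add
    (contDiff_const.mul (contDiff_rsPow 1))

/-- The family, viewed as a time-independent function `(t, w) ↦ G(w)`, is `Cⁿ` jointly (the
regularity hypothesis of the tree's Itô formula). [folklore] -/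
theorem contDiff_uncurry_rsSuperFamily {n : WithTop ℕ∞} :
    ContDiff ℝ n (Function.uncurry fun (_ : ℝ) (w : ℝ) ↦ rsSuperFamily β D E w) :=
  (contDiff_rsSuperFamily β D E).comp contDiff_snd

/-- **Linearity of the drift on the family**:
`D_{a,κ} G = 4a/s² + D · D_{a,κ}[s^{-β}] + E · D_{a,κ}[s^{-1}]`. [folklore] -/
theorem rsDriftOp_rsSuperFamily (κ a w : ℝ) :
    rsDriftOp κ a (rsSuperFamily β D E) w =
      4 * a / (1 + w ^ 2) ^ 2 + D * rsDriftOp κ a (rsPow β) w + E * rsDriftOp κ a (rsPow 1) w := by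
  simp only [rsDriftOp, iteratedDeriv_two_rsSuperFamily, deriv_rsSuperFamily_eq', rsSuperFamily]
  ring

/-- **The drift of the family in closed form** (`s = 1 + w²`):
`D_{a,κ} G = 4a/s² + D s^{-β}/s² ((4a-κβ) + β(2κβ+κ-8)w²) + E s^{-1}/s² ((4a-κ) + (3κ-8)w²)`.
[folklore] -/
theorem rsDriftOp_rsSuperFamily_eq (κ a w : ℝ) :
    rsDriftOp κ a (rsSuperFamily β D E) w =
      4 * a / (1 + w ^ 2) ^ 2 +
        D * ((1 + w ^ 2) ^ (-β) / (1 + w ^ 2) ^ 2 * ((4 * a - κ * β) + β * (2 * κ * β + κ - 8) * w ^ 2)) +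
        E * ((1 + w ^ 2) ^ (-(1 : ℝ)) / (1 + w ^ 2) ^ 2 * ((4 * a - κ) + (3 * κ - 8) * w ^ 2)) := by
  rw [rsDriftOp_rsSuperFamily, rsDriftOp_rsPow, rsDriftOp_rsPow]
  ring

end Family

/-! ### The generator inequality `D_{a,κ} G ≤ 0` -/

section Drift

variable {κ a : ℝ}

/-- **Case `a < κ/4`.** With `E = 0`, `4a/κ < β ≤ 1`, `2κβ + κ < 8` and
`D ≥ 4a/(κβ - 4a) + 4a/(8 - κ - 2κβ)`: `D_{a,κ}(1 + D s^{-β}) ≤ 0`, by Bernoulli's inequality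
`s^β ≤ 1 + βw²` exactly as in `rsSuperDrift_nonpos`. [folklore] -/
theorem rsSuperFamily_drift_nonpos_of_lt (h0 : 0 < κ) (ha : 0 ≤ a) {β D : ℝ} (hβa : 4 * a < κ * β)
    (hβ1 : β ≤ 1) (hβ0 : 2 * κ * β + κ < 8)
    (hD : 4 * a / (κ * β - 4 * a) + 4 * a / (8 - κ - 2 * κ * β) ≤ D) (w : ℝ) :
    rsDriftOp κ a (rsSuperFamily β D 0) w ≤ 0 := by
  rw [rsDriftOp_rsSuperFamily_eq, zero_mul, add_zero]
  have hu0 : 0 < 1 + w ^ 2 := one_add_sq_pos' w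
  have hβpos : 0 < β := by
    by_contra h
    push Not at h
    have : κ * β ≤ 0 := mul_nonpos_of_nonneg_of_nonpos h0.le h
    linarith
  have hD1 : 4 * a / (κ * β - 4 * a) ≤ D :=
    le_trans (le_add_of_nonneg_right (div_nonneg (by linarith) (by linarith))) hD
  have hD2 : 4 * a / (8 - κ - 2 * κ * β) ≤ D :=
    le_trans (le_add_of_nonneg_left (div_nonneg (by linarith) (by linarith))) hD
  have hD0 : 0 ≤ D := le_trans (div_nonneg (by linarith) (by linarith)) hD1
  have hD1' : 4 * a + D * (4 * a - κ * β) ≤ 0 := by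
    have h := (div_le_iff₀ (by linarith : (0 : ℝ) < κ * β - 4 * a)).1 hD1
    nlinarith
  have hD2' : 4 * a + D * (2 * κ * β + κ - 8) ≤ 0 := by
    have h := (div_le_iff₀ (by linarith : (0 : ℝ) < 8 - κ - 2 * κ * β)).1 hD2
    nlinarith
  -- rewrite `4a/s²` as `s^{-β}/s² · 4a s^β`
  have hp0 : 0 < (1 + w ^ 2) ^ (-β) := rpow_pos_of_pos hu0 _
  have h3 : (1 + w ^ 2) ^ β = ((1 + w ^ 2) ^ (-β))⁻¹ := by rw [rpow_neg hu0.le, inv_inv]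
  have hrw : 4 * a / (1 + w ^ 2) ^ 2 =
      (1 + w ^ 2) ^ (-β) / (1 + w ^ 2) ^ 2 * (4 * a * (1 + w ^ 2) ^ β) := by
    rw [h3]; field_simp
  rw [hrw]
  have hP : 0 ≤ (1 + w ^ 2) ^ (-β) / (1 + w ^ 2) ^ 2 := div_nonneg hp0.le (by positivity)
  -- Bernoulli
  have hB : (1 + w ^ 2) ^ β ≤ 1 + β * w ^ 2 :=
    rpow_one_add_le_one_add_mul_self (by nlinarith) hβpos.le hβ1
  have hw2 : 0 ≤ w ^ 2 := sq_nonneg w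
  have key : 4 * a * (1 + w ^ 2) ^ β + D * ((4 * a - κ * β) + β * (2 * κ * β + κ - 8) * w ^ 2) ≤ 0 :=
    calc 4 * a * (1 + w ^ 2) ^ β + D * ((4 * a - κ * β) + β * (2 * κ * β + κ - 8) * w ^ 2)
        ≤ 4 * a * (1 + β * w ^ 2) + D * ((4 * a - κ * β) + β * (2 * κ * β + κ - 8) * w ^ 2) := by
          gcongr
      _ = (4 * a + D * (4 * a - κ * β)) + β * w ^ 2 * (4 * a + D * (2 * κ * β + κ - 8)) := by ring
      _ ≤ 0 := by
          have := mul_nonpos_of_nonneg_of_nonpos (mul_nonneg hβpos.le hw2) hD2'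
          linarith
  calc (1 + w ^ 2) ^ (-β) / (1 + w ^ 2) ^ 2 * (4 * a * (1 + w ^ 2) ^ β) +
        D * ((1 + w ^ 2) ^ (-β) / (1 + w ^ 2) ^ 2 * ((4 * a - κ * β) + β * (2 * κ * β + κ - 8) * w ^ 2))
      = (1 + w ^ 2) ^ (-β) / (1 + w ^ 2) ^ 2 *
          (4 * a * (1 + w ^ 2) ^ β + D * ((4 * a - κ * β) + β * (2 * κ * β + κ - 8) * w ^ 2)) := by ring
    _ ≤ 0 := mul_nonpos_of_nonneg_of_nonpos hP key

/-- **Case `a ≥ κ/4`** (`0 < κ`). With `κβ > 4a` (so `β > 1`) and `2κβ + κ < 8` (together these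
force `a < 1 - κ/8` and `κ < 8/3`), `E = 8a/(8-3κ)`, `c₀ = 4a + E(4a-κ)`, `q = c₀/(4a)` and
`D = c₀ (1+q)^{β-1}/(κβ - 4a)`: `D_{a,κ}(1 + D s^{-β} + E s^{-1}) ≤ 0`. The terms `4a/s²` and
`E · D[s^{-1}]` add up to `s^{-3}(c₀ - 4a w²)`; where this is positive (`w² < q`) it is dominated by
`-D(κβ - 4a) s^{-β-2} ≥ -D · D[s^{-β}]`. [folklore] -/
theorem rsSuperFamily_drift_nonpos_of_le (h0 : 0 < κ) (hκa : κ ≤ 4 * a)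
    {β : ℝ} (hβa : 4 * a < κ * β) (hβ0 : 2 * κ * β + κ < 8) (w : ℝ) :
    rsDriftOp κ a (rsSuperFamily β
      ((4 * a + 8 * a / (8 - 3 * κ) * (4 * a - κ)) *
          (1 + (4 * a + 8 * a / (8 - 3 * κ) * (4 * a - κ)) / (4 * a)) ^ (β - 1) / (κ * β - 4 * a))
      (8 * a / (8 - 3 * κ))) w ≤ 0 := by
  -- the parameters
  have ha0 : 0 < a := by linarith
  have hκ3 : 0 < 8 - 3 * κ := by linarith
  set E : ℝ := 8 * a / (8 - 3 * κ) with hE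
  have hE0 : 0 ≤ E := div_nonneg (by linarith) hκ3.le
  set c₀ : ℝ := 4 * a + E * (4 * a - κ) with hc₀
  have hc₀0 : 0 < c₀ := by
    have : 0 ≤ E * (4 * a - κ) := mul_nonneg hE0 (by linarith)
    linarith
  set q : ℝ := c₀ / (4 * a) with hq
  have hq0 : 0 < q := div_pos hc₀0 (by linarith)
  have hβ1 : 1 < β := by
    by_contra h
    push Not at h
    have : κ * β ≤ κ * 1 := mul_le_mul_of_nonneg_left h h0.le
    linarith
  have hgap : 0 < κ * β - 4 * a := by linarith
  set D : ℝ := c₀ * (1 + q) ^ (β - 1) / (κ * β - 4 * a) with hD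
  have hpow0 : 0 < (1 + q) ^ (β - 1) := rpow_pos_of_pos (by linarith) _
  have hD0 : 0 ≤ D := div_nonneg (mul_nonneg hc₀0.le hpow0.le) hgap.le
  -- the drift
  rw [rsDriftOp_rsSuperFamily_eq]
  set s : ℝ := 1 + w ^ 2 with hs
  have hs0 : 0 < s := one_add_sq_pos' w
  have hs1 : 1 ≤ s := by rw [hs]; nlinarith
  have hw2 : 0 ≤ w ^ 2 := sq_nonneg w
  -- (i) `4a/s² + E s^{-1}/s² ((4a-κ)+(3κ-8)w²) = (c₀ - 4a w²)/s³`
  have hEterm : 4 * a / s ^ 2 + E * (s ^ (-(1 : ℝ)) / s ^ 2 * ((4 * a - κ) + (3 * κ - 8) * w ^ 2)) =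
      (c₀ - 4 * a * w ^ 2) / s ^ 3 := by
    have hE8 : E * (3 * κ - 8) = -8 * a := by
      rw [hE]; field_simp; ring
    rw [rpow_neg_one, hc₀]
    field_simp
    rw [hs]
    linear_combination (w ^ 2) * hE8
  -- (ii) the `D`-term is at most `-D(κβ-4a) s^{-β}/s²`
  have hsp0 : 0 < s ^ (-β) := rpow_pos_of_pos hs0 _
  have hDterm : D * (s ^ (-β) / s ^ 2 * ((4 * a - κ * β) + β * (2 * κ * β + κ - 8) * w ^ 2)) ≤
      -(D * (κ * β - 4 * a)) * (s ^ (-β) / s ^ 2) := by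
    have hneg : β * (2 * κ * β + κ - 8) * w ^ 2 ≤ 0 :=
      mul_nonpos_of_nonpos_of_nonneg (mul_nonpos_of_nonneg_of_nonpos (by linarith) (by linarith)) hw2
    have hfac : 0 ≤ D * (s ^ (-β) / s ^ 2) := mul_nonneg hD0 (div_nonneg hsp0.le (by positivity))
    nlinarith
  -- (iii) `D(κβ-4a) = c₀ (1+q)^{β-1}`
  have hDgap : D * (κ * β - 4 * a) = c₀ * (1 + q) ^ (β - 1) := by
    rw [hD, div_mul_cancel₀ _ hgap.ne']
  rw [hDgap] at hDterm
  -- it remains to show `(c₀ - 4a w²)/s³ - c₀ (1+q)^{β-1} · (s^{-β}/s²) ≤ 0`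
  suffices hfinal : (c₀ - 4 * a * w ^ 2) / s ^ 3 +
      -(c₀ * (1 + q) ^ (β - 1)) * (s ^ (-β) / s ^ 2) ≤ 0 by
    linarith
  by_cases hℓ : c₀ - 4 * a * w ^ 2 ≤ 0
  · have h1 : (c₀ - 4 * a * w ^ 2) / s ^ 3 ≤ 0 := div_nonpos_of_nonpos_of_nonneg hℓ (by positivity)
    have h2 : 0 ≤ c₀ * (1 + q) ^ (β - 1) * (s ^ (-β) / s ^ 2) :=
      mul_nonneg (mul_nonneg hc₀0.le hpow0.le) (div_nonneg hsp0.le (by positivity))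
    linarith
  · push Not at hℓ
    -- here `w² < q`, so `s ≤ 1 + q` and `(1+q)^{β-1} s^{-β} ≥ s^{β-1} s^{-β} = 1/s`
    have hwq : w ^ 2 < q := by
      rw [hq, lt_div_iff₀ (by linarith)]
      linarith
    have hsq : s ≤ 1 + q := by rw [hs]; linarith
    have hmono : s ^ (β - 1) ≤ (1 + q) ^ (β - 1) := rpow_le_rpow hs0.le hsq (by linarith)
    have hkey : 1 / s ≤ (1 + q) ^ (β - 1) * s ^ (-β) := by
      have hsβ : s ^ (β - 1) * s ^ (-β) = 1 / s := by
        rw [← rpow_add hs0, show β - 1 + -β = -1 by ring, rpow_neg_one, one_div]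
      rw [← hsβ]
      exact mul_le_mul_of_nonneg_right hmono hsp0.le
    -- compare
    have hnum : c₀ - 4 * a * w ^ 2 ≤ c₀ := by nlinarith
    have hs3 : (0 : ℝ) < s ^ 3 := by positivity
    have hs2 : (0 : ℝ) < s ^ 2 := by positivity
    have step1 : (c₀ - 4 * a * w ^ 2) / s ^ 3 ≤ c₀ / s ^ 3 := div_le_div_of_nonneg_right hnum hs3.le
    have step2 : c₀ / s ^ 3 = c₀ * (1 / s) / s ^ 2 := by field_simp
    have step3 : c₀ * (1 / s) / s ^ 2 ≤ c₀ * ((1 + q) ^ (β - 1) * s ^ (-β)) / s ^ 2 :=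
      div_le_div_of_nonneg_right (mul_le_mul_of_nonneg_left hkey hc₀0.le) hs2.le
    have step4 : c₀ * ((1 + q) ^ (β - 1) * s ^ (-β)) / s ^ 2 =
        c₀ * (1 + q) ^ (β - 1) * (s ^ (-β) / s ^ 2) := by ring
    linarith

/-- **Existence of an elementary supersolution for every moment `a < 1 - κ/8`.** For `0 < κ`
and `0 ≤ a < 1 - κ/8` (so `κ < 8`) there are `β, D, E ≥ 0` such that `G = rsSuperFamily β D E` — a smooth
function with `1 ≤ G ≤ 1 + D + E` — satisfies Rohde–Schramm's generator inequality
`D_{a,κ} G ≤ 0` on `ℝ`. This replaces the hypergeometric `Ĝ_{a,κ}` and the estimate (6.10)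
`inf Ĝ > 0` of the printed proof of Lemma 6.3 for the purpose of bounding `E[Z^a]` from above, in
the full printed range `a < 1 - κ/8` of finite moments. [cite: RohdeSchramm2005, Lemma 6.3] -/
theorem exists_rsSuperFamily_drift_nonpos (h0 : 0 < κ) (ha : 0 ≤ a) (ha8 : a < 1 - κ / 8) :
    ∃ β D E : ℝ, 0 ≤ β ∧ 0 ≤ D ∧ 0 ≤ E ∧ ∀ w, rsDriftOp κ a (rsSuperFamily β D E) w ≤ 0 := by
  -- `β₀ = (8-κ)/(2κ)` and `4a/κ < β₀`
  have hβ₀ : 4 * a / κ < (8 - κ) / (2 * κ) := by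
    rw [div_lt_div_iff₀ h0 (by linarith)]
    nlinarith
  have h4a : 0 ≤ 4 * a / κ := div_nonneg (by linarith) h0.le
  by_cases hcase : 4 * a < κ
  · -- Case `a < κ/4`: `β` = midpoint of `4a/κ` and `min 1 β₀`, `E = 0`
    set m : ℝ := min 1 ((8 - κ) / (2 * κ)) with hm
    have hlt : 4 * a / κ < m := lt_min (by rwa [div_lt_one h0]) hβ₀
    set β : ℝ := (4 * a / κ + m) / 2 with hβ
    have hβlo : 4 * a / κ < β := by rw [hβ]; linarith
    have hβhi : β < m := by rw [hβ]; linarith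
    have hβa : 4 * a < κ * β := by
      have := (div_lt_iff₀ h0).1 hβlo
      linarith
    have hβ1 : β ≤ 1 := (hβhi.trans_le (min_le_left _ _)).le
    have hβ0 : 2 * κ * β + κ < 8 := by
      have h := hβhi.trans_le (min_le_right _ _)
      rw [lt_div_iff₀ (by linarith)] at h
      linarith
    refine ⟨β, 4 * a / (κ * β - 4 * a) + 4 * a / (8 - κ - 2 * κ * β), 0, h4a.trans hβlo.le,
      add_nonneg (div_nonneg (by linarith) (by linarith)) (div_nonneg (by linarith) (by linarith)),
      le_rfl, fun w ↦ ?_⟩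
    exact rsSuperFamily_drift_nonpos_of_lt h0 ha hβa hβ1 hβ0 le_rfl w
  · -- Case `a ≥ κ/4`: `β` = midpoint of `4a/κ` and `β₀`
    push Not at hcase
    set β : ℝ := (4 * a / κ + (8 - κ) / (2 * κ)) / 2 with hβ
    have hβlo : 4 * a / κ < β := by rw [hβ]; linarith
    have hβhi : β < (8 - κ) / (2 * κ) := by rw [hβ]; linarith
    have hβa : 4 * a < κ * β := by
      have := (div_lt_iff₀ h0).1 hβlo
      linarith
    have hβ0 : 2 * κ * β + κ < 8 := by
      have h := hβhi
      rw [lt_div_iff₀ (by linarith)] at h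
      linarith
    have ha0 : 0 < a := by linarith
    have hκ3 : 0 < 8 - 3 * κ := by linarith
    have hE0 : 0 ≤ 8 * a / (8 - 3 * κ) := div_nonneg (by linarith) hκ3.le
    have hc₀0 : 0 ≤ 4 * a + 8 * a / (8 - 3 * κ) * (4 * a - κ) := by
      have : 0 ≤ 8 * a / (8 - 3 * κ) * (4 * a - κ) := mul_nonneg hE0 (by linarith)
      linarith
    refine ⟨β, _, 8 * a / (8 - 3 * κ), h4a.trans hβlo.le, ?_, hE0,
      fun w ↦ rsSuperFamily_drift_nonpos_of_le h0 hcase hβa hβ0 w⟩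
    exact div_nonneg (mul_nonneg hc₀0 (rpow_pos_of_pos (by positivity) _).le) (by linarith)

/-- The existence statement in the form consumed by the stochastic layer: a `C²` profile `G` with
two-sided bounds `1 ≤ G ≤ M` and `D_{a,κ} G ≤ 0`. [cite: RohdeSchramm2005, Lemma 6.3] -/
theorem exists_supersolution_rsDriftOp (h0 : 0 < κ) (ha : 0 ≤ a) (ha8 : a < 1 - κ / 8) :
    ∃ (G : ℝ → ℝ) (M : ℝ), ContDiff ℝ 2 G ∧ (∀ w, 1 ≤ G w) ∧ (∀ w, G w ≤ M) ∧
      ∀ w, rsDriftOp κ a G w ≤ 0 := by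
  obtain ⟨β, D, E, hβ, hD, hE, h⟩ := exists_rsSuperFamily_drift_nonpos h0 ha ha8
  exact ⟨rsSuperFamily β D E, 1 + D + E, contDiff_rsSuperFamily β D E, one_le_rsSuperFamily hD hE,
    rsSuperFamily_le hβ hD hE, h⟩

end Drift

end Literature.Probability.RandomPlanarGeometry
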